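import Summits.Ventures.PercRepro.C041ZoneZSkelDict

/-!
# CONJECTURE (INV) IS A THEOREM (p6, gen 27; C-041.md §13, THEOREM (INV) — part 3)

Setting of `C041ZoneZSkelDict`, with the anchor set `K₀ = K(O) = BareReach a b c O` and the protected anchor `c`.
For a cube state `S` (σ = `toState S`): `K K₀ σ = K(S)` (`skel_K_eq`), «blue at `K`» is invalidity (`skel_blueK_iff`),
«no anchor deleted» gives `ρ_a(u)` for every `u ∈ K₀` along the red `O`-walk from the probe (`skel_rhoA_of_not_anchorDel`)
and conversely `¬ρ_a(u)` deletes an anchor (`skel_anchorDel_of_not_rhoA`), and «no red `2`-edge at `REACH`» with no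
anchor deleted forbids `Good_a` (`skel_not_goodA_of_reach2`, by the first-arrival decomposition
`exists_bareWalkAvoiding_of_goodA`).  Hence the two inclusions of §13: `{invalid ∧ ¬ρ_a(u)}` injects into `𝓛_Z`
(`invNotRhoCountA_le_card_LsetF`) and `𝓡_Z` injects into `{valid ∧ ¬Good_a ∧ ρ_a(u)}` (`card_RsetF_le_validNotGoodRhoCountA`),
and THEOREM Z′ (`card_LsetF_le_card_RsetF`) gives `I(O) ≤ m_a(u)` (`invalidCount_le_mCountA_skel`); side `b` by the
symmetry of `C041ZoneSplitSymm` (`invalidCount_le_mCountB_skel`).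

* **`INVConj_holds`** — mine-3's CONJECTURE (INV) (`INVConj`, `C041RcPortINV`) holds for every skeleton `(G; a, b, c)`
  with `c` a non-terminal, distinct terminals and an edge between them: for every bare colouring `O` and every
  `u ∈ K(O)`, `I(O) ≤ m_a(u)` and `I(O) ≤ m_b(u)`.  (The hypothesis «`u` carries no terminal edge» of `INVConj` is not
  used.)
-/

namespace PercRepro

namespace MultiGraph

open Finset ZoneZ ZoneZ.ZoneData

variable {V E : Type*} {G : MultiGraph V E} {a b c : V}

section Dict

variable (O S : Config E)

/-- The anchors are non-terminals. -/
theorem ne_terminal_of_mem_bareReach_O (hc : c ≠ a ∧ c ≠ b) {v : V} (hv : v ∈ G.BareReach a b c O) :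
    v ≠ a ∧ v ≠ b :=
  ne_terminal_of_bareReach hv hc

/-- `K` with the anchor set `K₀` is `K(S)` for a cube state. -/
theorem skel_K_eq (hc : c ≠ a ∧ c ≠ b) (hS : ∀ e, G.Bare a b e → O e = true → S e = true) :
    (G.skelZone a b O).K (G.BareReach a b c O) (G.toState a b S) = G.BareReach a b c S := by
  ext v
  unfold ZoneData.K
  rw [skel_mem_reach_red_iff O S (fun s hs => ne_terminal_of_mem_bareReach_O O hc hs)]
  constructor
  · rintro ⟨s, hs, hsv⟩
    exact Relation.ReflTransGen.trans (bareReach_O_subset a b c hS hs) hsv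
  · intro h
    exact ⟨c, Relation.ReflTransGen.refl, h⟩

/-- «Blue at `K`» is invalidity, for a cube state with an edge between the terminals. -/
theorem skel_blueK_iff [Fintype V] [Fintype E] [DecidableEq E] (hc : c ≠ a ∧ c ≠ b) (hab : ∃ e, G.Joins e a b)
    (hS : G.IsCubeState a b c O S) :
    (G.skelZone a b O).blueK (G.BareReach a b c O) (G.toState a b S) ↔ G.RcInvalid a b c S := by
  unfold ZoneData.blueK
  rw [skel_K_eq O S hc hS.1, rcInvalid_iff a b c hc hab hS]
  constructor
  · intro h w hw e hj
    by_contra hSe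
    have hSe' : S e = true := by
      cases h' : S e
      · exact absurd h' hSe
      · rfl
    have hw' := ne_terminal_of_bareReach hw hc
    refine Set.disjoint_left.1 h hw ?_
    rcases hj with hj | hj
    · exact Or.inl ((skel_mem_Blt_iff O S w).2 ⟨hw', e, hj, hSe'⟩)
    · exact Or.inr ((skel_mem_Mt_iff O S w).2 ⟨hw', e, hj, hSe'⟩)
  · intro h
    rw [Set.disjoint_left]
    intro w hw hw'
    rcases hw' with hw' | hw'
    · obtain ⟨_, e, hj, hSe⟩ := (skel_mem_Blt_iff O S w).1 hw'
      rw [h w hw e (Or.inl hj)] at hSe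
      exact absurd hSe (by decide)
    · obtain ⟨_, e, hj, hSe⟩ := (skel_mem_Mt_iff O S w).1 hw'
      rw [h w hw e (Or.inr hj)] at hSe
      exact absurd hSe (by decide)

/-- For an admissible state a non-terminal lies outside the blue cluster of `a` iff it is not deleted. -/
theorem skel_not_mem_cluster_iff (hadm : ¬ G.Conn Sᶜ a b) {v : V} (hv : v ≠ a ∧ v ≠ b) :
    v ∉ G.cluster Sᶜ a ↔ v ∉ (G.skelZone a b O).D (G.toState a b S) := by
  rw [mem_cluster_compl_iff_attached a b hadm hv, skel_mem_D_iff O S hv]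

/-- **No anchor deleted gives `ρ_a(u)`** for every `u ∈ K₀`: the red bare `O`-walk from the probe to `u` runs inside
`K₀` and avoids the blue cluster of `a`. -/
theorem skel_rhoA_of_not_anchorDel (hc : c ≠ a ∧ c ≠ b) (hadm : ¬ G.Conn Sᶜ a b)
    (hS : ∀ e, G.Bare a b e → O e = true → S e = true) {u : V} (hu : u ∈ G.BareReach a b c O)
    (h : ¬ (G.skelZone a b O).anchorDel (G.BareReach a b c O) (G.toState a b S)) : G.RhoA a c S u := by
  have hnd : ∀ v ∈ G.BareReach a b c O, v ∉ G.cluster Sᶜ a := by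
    intro v hv
    rw [skel_not_mem_cluster_iff O S hadm (ne_terminal_of_mem_bareReach_O O hc hv)]
    intro hvD
    exact h ⟨v, hv, hvD⟩
  refine ⟨hnd c Relation.ReflTransGen.refl, ?_⟩
  induction hu with
  | refl => exact Relation.ReflTransGen.refl
  | tail hpre hxy ih =>
    exact ih.tail ⟨(bareAdj_of_bareAdj_O a b hS hxy).openAdj, hnd _ (hpre.tail hxy)⟩

/-- **`¬ρ_a(u)` deletes an anchor.** -/
theorem skel_anchorDel_of_not_rhoA (hc : c ≠ a ∧ c ≠ b) (hadm : ¬ G.Conn Sᶜ a b)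
    (hS : ∀ e, G.Bare a b e → O e = true → S e = true) {u : V} (hu : u ∈ G.BareReach a b c O)
    (h : ¬ G.RhoA a c S u) : (G.skelZone a b O).anchorDel (G.BareReach a b c O) (G.toState a b S) := by
  by_contra h'
  exact h (skel_rhoA_of_not_anchorDel O S hc hadm hS hu h')

/-- A red bare walk from the probe avoiding the blue cluster of `a` ends in `REACH` (no anchor deleted). -/
theorem skel_mem_REACH_of_bareWalkAvoiding (hc : c ≠ a ∧ c ≠ b) (hadm : ¬ G.Conn Sᶜ a b)
    (hcD : c ∉ (G.skelZone a b O).D (G.toState a b S)) {w : V}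
    (hw : Relation.ReflTransGen (fun x y => G.BareAdj a b S x y ∧ y ∉ G.cluster Sᶜ a) c w) :
    w ∈ (G.skelZone a b O).REACH (G.BareReach a b c O) (G.toState a b S) := by
  unfold ZoneData.REACH ZoneData.reachIn
  induction hw with
  | refl => exact mem_reach_of_mem ⟨Relation.ReflTransGen.refl, hcD⟩
  | tail hpre hxy ih =>
    have hx' := ne_terminal_of_bareReach (bareWalk_of_avoiding a b hpre) hc
    have hy' := ne_terminal_of_bareReach (bareWalk_of_avoiding a b (hpre.tail hxy)) hc
    have hyD : _ ∉ (G.skelZone a b O).D (G.toState a b S) :=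
      (skel_not_mem_cluster_iff O S hadm hy').1 hxy.2
    exact reach_tail ih ⟨(skel_redAdj_iff O S hx').2 hxy.1, reachIn_subset ih, hyD⟩

/-- **No red `2`-edge at `REACH` forbids `Good_a`** when no anchor is deleted: a red walk from the probe to `b` avoiding
the blue cluster of `a` would end with a red `b`-edge at a vertex of `REACH`. -/
theorem skel_not_goodA_of_reach2 (hc : c ≠ a ∧ c ≠ b) (hadm : ¬ G.Conn Sᶜ a b)
    (hnd : ¬ (G.skelZone a b O).anchorDel (G.BareReach a b c O) (G.toState a b S))
    (h2 : (G.skelZone a b O).reach2 (G.BareReach a b c O) (G.toState a b S)) :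
    ¬ G.WalkAvoiding S (G.cluster Sᶜ a) c b := by
  intro hg
  obtain ⟨w, hw, _, e, hSe, hj⟩ := exists_bareWalkAvoiding_of_goodA a b c hc hg
  have hw' : w ≠ a ∧ w ≠ b := ne_terminal_of_bareReach (bareWalk_of_avoiding a b hw) hc
  have hwMt : w ∈ (G.skelZone a b O).Mt (G.toState a b S) := (skel_mem_Mt_iff O S w).2 ⟨hw', e, hj, hSe⟩
  have hcD : c ∉ (G.skelZone a b O).D (G.toState a b S) := fun hcD => hnd ⟨c, Relation.ReflTransGen.refl, hcD⟩
  exact Set.disjoint_left.1 h2 (skel_mem_REACH_of_bareWalkAvoiding O S hc hadm hcD hw) hwMt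

end Dict

section Count

variable [Fintype V] [Fintype E] [DecidableEq E] (O : Config E)

open Classical in
/-- **(L)**: the states `{invalid ∧ ¬ρ_a(u)}` inject into `𝓛_Z` of the skeleton zone. -/
theorem invNotRhoCountA_le_card_LsetF (hc : c ≠ a ∧ c ≠ b) (hne : a ≠ b) (hab : ∃ e, G.Joins e a b) {u : V}
    (hu : u ∈ G.BareReach a b c O) :
    G.invNotRhoCountA a b c O u ≤ ((G.skelZone a b O).LsetF {c} (G.BareReach a b c O)).card := by
  unfold invNotRhoCountA cubeStateSet
  refine Finset.card_le_card_of_injOn (G.toState a b) ?_ fun S _ S' _ h => toState_injective h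
  intro S hS
  rw [Finset.mem_coe, Finset.mem_filter, Finset.mem_filter] at hS
  obtain ⟨⟨_, hcube⟩, hinv, hrho⟩ := hS
  rw [Finset.mem_coe, FZone.mem_LsetF]
  have hadm : ¬ G.Conn Sᶜ a b := hcube.2.2.2.2
  obtain ⟨hF, hA, hG⟩ := (skel_isCubeState_iff O S hc hne).1 hcube
  exact ⟨hF, hA, (skel_blueK_iff O S hc hab hcube).2 hinv,
    skel_anchorDel_of_not_rhoA O S hc hadm hcube.1 hu hrho, hG⟩

open Classical in
/-- **(R)**: `𝓡_Z` of the skeleton zone injects into the states `{valid ∧ ¬Good_a ∧ ρ_a(u)}`. -/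
theorem card_RsetF_le_validNotGoodRhoCountA (hc : c ≠ a ∧ c ≠ b) (hne : a ≠ b) (hab : ∃ e, G.Joins e a b)
    {u : V} (hu : u ∈ G.BareReach a b c O) :
    ((G.skelZone a b O).RsetF {c} (G.BareReach a b c O)).card ≤ G.validNotGoodRhoCountA a b c O u := by
  unfold validNotGoodRhoCountA cubeStateSet
  refine Finset.card_le_card_of_injOn (G.ofState a b) ?_ fun σ _ σ' _ h => ofState_injective hne h
  intro σ hσ
  rw [Finset.mem_coe, FZone.mem_RsetF] at hσ
  rw [Finset.mem_coe, Finset.mem_filter, Finset.mem_filter]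
  set S := G.ofState a b σ with hSdef
  have hσS : G.toState a b S = σ := toState_ofState hne σ
  rw [← hσS] at hσ
  obtain ⟨hF, hA, hnd, h2, hK, hG⟩ := hσ
  have hcube : G.IsCubeState a b c O S := (skel_isCubeState_iff O S hc hne).2 ⟨hF, hA, hG⟩
  have hadm : ¬ G.Conn Sᶜ a b := hcube.2.2.2.2
  refine ⟨⟨Finset.mem_univ _, hcube⟩, ?_, skel_not_goodA_of_reach2 O S hc hadm hnd h2,
    skel_rhoA_of_not_anchorDel O S hc hadm hcube.1 hu hnd⟩
  intro hinv
  exact hK ((skel_blueK_iff O S hc hab hcube).2 hinv)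

open Classical in
/-- **(INV), side `a`**: `I(O) ≤ m_a(u)` for every `u ∈ K₀` — THEOREM Z′ on the skeleton zone with anchor set `K₀`. -/
theorem invalidCount_le_mCountA_skel (hc : c ≠ a ∧ c ≠ b) (hne : a ≠ b) (hab : ∃ e, G.Joins e a b) {u : V}
    (hu : u ∈ G.BareReach a b c O) : G.invalidCount a b c O ≤ G.mCountA a b c O u :=
  invalidCount_le_mCountA_of_reduced a b c hab O u
    ((invNotRhoCountA_le_card_LsetF O hc hne hab hu).trans
      (((G.skelZone a b O).card_LsetF_le_card_RsetF {c} (G.BareReach a b c O)).trans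
        (card_RsetF_le_validNotGoodRhoCountA O hc hne hab hu)))

/-- **(INV), side `b`**, by the symmetry of the terminals. -/
theorem invalidCount_le_mCountB_skel (hc : c ≠ a ∧ c ≠ b) (hne : a ≠ b) (hab : ∃ e, G.Joins e a b) {u : V}
    (hu : u ∈ G.BareReach a b c O) : G.invalidCount a b c O ≤ G.mCountB a b c O u := by
  obtain ⟨e, he⟩ := hab
  have h := invalidCount_le_mCountA_skel (a := b) (b := a) (c := c) O ⟨hc.2, hc.1⟩ hne.symm ⟨e, he.symm⟩
    (by rw [bareReach_comm]; exact hu)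
  rw [invalidCount_comm, mCountA_comm] at h
  exact h

/-- **CONJECTURE (INV) HOLDS** (C-041.md §10 / §13): for a skeleton `(G; a, b, c)` with `c` a non-terminal, distinct
terminals and an edge between them, `I(O) ≤ m_a(u)` and `I(O) ≤ m_b(u)` for every bare colouring `O` and every vertex
`u` of `K(O)` carrying no terminal edge. -/
theorem INVConj_holds (hc : c ≠ a ∧ c ≠ b) (hne : a ≠ b) (hab : ∃ e, G.Joins e a b) : G.INVConj a b c :=
  fun O _ hu _ => ⟨invalidCount_le_mCountA_skel O hc hne hab hu, invalidCount_le_mCountB_skel O hc hne hab hu⟩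

end Count

end MultiGraph

end PercRepro
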